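import Mathlib
import Summits.ValiantsHypothesis.ValiantsHypothesis.Theorems.NewtonUnitEquationsTwoProductsPencil
/-! # Stub `stub_engineNetTransversal` — crux `TwoProducts` (stmt-ValiantsHypothesis-5906), line `corner-log-linearization`
   The NET RUNG of the engine with transversal generators: all `2n` factors lie in the net
   `1 + ℂ B + ℂ C` spanned by two constant-free bivariate polynomials `B`, `C` whose monomials are
   never radially aligned (`b₀ c₁ ≠ b₁ c₀` for `b ∈ supp B`, `c ∈ supp C`).  Then
   `D = ∏ (1 + α_i B + α'_i C) - ∏ (1 + β_i B + β'_i C) = P(B, C) = ∑_s P_s • B ^ s₀ * C ^ s₁` for the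
   bivariate net polynomial `P = ∏ (1 + α_i X + α'_i Y) - ∏ (1 + β_i X + β'_i Y)`, whose exponents
   are at most `n` in each coordinate.  Fix a positive weight `w` and a strict `w`-minimiser `e` of
   `supp D` (a south-west vertex).  Perturb `w` to the additive integer weight
   `ω = K • wt_w + x-coordinate` with `K` exceeding every `x`-coordinate in
   `supp D ∪ supp B ∪ supp C` and exceeding `n (b₀ + c₀)` for all `b ∈ supp B`, `c ∈ supp C`.
   Then `supp B`, `supp C` have strict `ω`-minimisers `b̂`, `ĉ`, strict minimisers multiply, so
   `s₀ • b̂ + s₁ • ĉ` is the strict `ω`-minimiser of `supp (B ^ s₀ * C ^ s₁)`, of weight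
   `F s = s₀ ω(b̂) + s₁ ω(ĉ)`.  KEY: transversality makes `F` injective on exponents `≤ (n, n)`
   (a tie forces a `2 × 2` linear system with determinant `b̂₀ ĉ₁ - b̂₁ ĉ₀ ≠ 0`).  Hence the unique
   `F`-minimiser `s⋆ ∈ supp P` yields the strict `ω`-minimiser `s⋆₀ • b̂ + s⋆₁ • ĉ` of `supp D`, and as
   `ω` refines `wt_w` strictly on `supp D`, `e = s⋆₀ • b̂ + s⋆₁ • ĉ`.  So the vertex set lies in the
   image of `[0, n]² × supp B × supp C`, of cardinality at most `(n + 1)² |supp B| |supp C|`.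
   [folklore] -/
set_option linter.dupNamespace false -- single-conjunct summit: `ValiantsHypothesis.ValiantsHypothesis`
namespace Summit.ValiantsHypothesis.ValiantsHypothesis.Theorems.TwoProducts.NetTransversal
open scoped BigOperators
open MvPolynomial
open Summit.ValiantsHypothesis.ValiantsHypothesis.Theorems.TwoProducts.Pencil

/-- With the perturbed weight `ω = K • wt_w + x` (`w 1 ≠ 0`), a nonempty finite set of exponents
whose `x`-coordinates are `< K` has a STRICT `ω`-minimiser: `ω` is injective there. [folklore] -/
theorem exists_strictMin (K : ℤ) (w : Fin 2 → ℤ) (hw1 : w 1 ≠ 0) (ω : (Fin 2 →₀ ℕ) → ℤ)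
    (hω : ∀ q, ω q = K * (w 0 * (q 0 : ℤ) + w 1 * (q 1 : ℤ)) + (q 0 : ℤ))
    (S : Finset (Fin 2 →₀ ℕ)) (hS : S.Nonempty) (hK : ∀ q ∈ S, ((q 0 : ℕ) : ℤ) < K) :
    ∃ v ∈ S, ∀ p ∈ S, p ≠ v → ω v < ω p := by
  obtain ⟨v, hv, hvle⟩ := Finset.exists_min_image S ω hS
  refine ⟨v, hv, fun p hp hpv => lt_of_le_of_ne (hvle p hp) fun heq => hpv ?_⟩
  have hvK := hK v hv
  have hpK := hK p hp
  rw [hω, hω] at heq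
  have hwt : w 0 * (v 0 : ℤ) + w 1 * (v 1 : ℤ) = w 0 * (p 0 : ℤ) + w 1 * (p 1 : ℤ) := by
    by_contra hne
    rcases lt_or_gt_of_ne hne with hlt | hlt
    · exact absurd heq (K_separates (Nat.cast_nonneg _) hvK (Nat.cast_nonneg _) hlt).ne
    · exact absurd heq.symm (K_separates (Nat.cast_nonneg _) hpK (Nat.cast_nonneg _) hlt).ne
  have hx0 : ((p 0 : ℕ) : ℤ) = v 0 := by rw [hwt] at heq; linarith
  have hx1 : ((p 1 : ℕ) : ℤ) = v 1 := by
    rw [← hx0] at hwt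
    have h2 : w 1 * ((p 1 : ℕ) : ℤ) = w 1 * (v 1 : ℤ) := by linarith
    exact mul_left_cancel₀ hw1 h2
  ext i
  fin_cases i
  · exact_mod_cast hx0
  · exact_mod_cast hx1

/-- **Key injectivity of the net rung.** For transversal exponents `b`, `c` (`b₀ c₁ ≠ b₁ c₀`) and
the perturbed weight `ω = K • wt_w + x` with `w 1 ≠ 0` and `K > N b₀ + N c₀`, the map
`s ↦ s₀ ω(b) + s₁ ω(c)` is injective on exponents `s ≤ (N, N)`: a tie forces the integer
`wt`-part and the `x`-part to vanish separately (`K`-separation), a `2 × 2` linear system with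
nonzero determinant. [folklore] -/
theorem nsmul_wt_injective (K : ℤ) (w : Fin 2 → ℤ) (hw1 : w 1 ≠ 0) (ω : (Fin 2 →₀ ℕ) → ℤ)
    (hω : ∀ q, ω q = K * (w 0 * (q 0 : ℤ) + w 1 * (q 1 : ℤ)) + (q 0 : ℤ))
    (b c : Fin 2 →₀ ℕ) (hbc : b 0 * c 1 ≠ b 1 * c 0) (N : ℕ)
    (hK : (N : ℤ) * (b 0 : ℤ) + (N : ℤ) * (c 0 : ℤ) < K)
    (s s' : Fin 2 →₀ ℕ) (hs : s 0 ≤ N ∧ s 1 ≤ N) (hs' : s' 0 ≤ N ∧ s' 1 ≤ N)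
    (heq : (s 0 : ℤ) * ω b + (s 1 : ℤ) * ω c = (s' 0 : ℤ) * ω b + (s' 1 : ℤ) * ω c) :
    s = s' := by
  rw [hω, hω] at heq
  obtain ⟨j, hj⟩ : ∃ j : ℤ, j = (s 0 : ℤ) - (s' 0 : ℤ) := ⟨_, rfl⟩
  obtain ⟨k, hk⟩ : ∃ k : ℤ, k = (s 1 : ℤ) - (s' 1 : ℤ) := ⟨_, rfl⟩
  obtain ⟨hs0, hs1⟩ := hs
  obtain ⟨hs0', hs1'⟩ := hs'
  have hj1 : j ≤ N := by omega
  have hj2 : -(N : ℤ) ≤ j := by omega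
  have hk1 : k ≤ N := by omega
  have hk2 : -(N : ℤ) ≤ k := by omega
  have hN0 : (0 : ℤ) ≤ N := Nat.cast_nonneg _
  have hb0 : (0 : ℤ) ≤ (b 0 : ℕ) := Nat.cast_nonneg _
  have hc0 : (0 : ℤ) ≤ (c 0 : ℕ) := Nat.cast_nonneg _
  have hK0 : (0 : ℤ) < K := by
    have h1 := mul_nonneg hN0 hb0
    have h2 := mul_nonneg hN0 hc0
    linarith
  -- the `wt`-part `X` of the tie
  obtain ⟨X, hX⟩ : ∃ X : ℤ, X = j * (w 0 * ((b 0 : ℕ) : ℤ) + w 1 * ((b 1 : ℕ) : ℤ)) +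
      k * (w 0 * ((c 0 : ℕ) : ℤ) + w 1 * ((c 1 : ℕ) : ℤ)) := ⟨_, rfl⟩
  -- the tie reads `K * X + Y = 0`
  have hXY : K * X + (j * ((b 0 : ℕ) : ℤ) + k * ((c 0 : ℕ) : ℤ)) = 0 := by
    rw [hX, hj, hk]; linear_combination heq
  -- `|Y| < K`
  have hY1 : j * ((b 0 : ℕ) : ℤ) + k * ((c 0 : ℕ) : ℤ) < K := by
    have h1 := mul_le_mul_of_nonneg_right hj1 hb0
    have h2 := mul_le_mul_of_nonneg_right hk1 hc0
    linarith
  have hY2 : -K < j * ((b 0 : ℕ) : ℤ) + k * ((c 0 : ℕ) : ℤ) := by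
    have h1 := mul_le_mul_of_nonneg_right hj2 hb0
    have h2 := mul_le_mul_of_nonneg_right hk2 hc0
    linarith
  -- hence `X = 0` and `Y = 0`
  have hX0 : X = 0 := by
    rcases lt_trichotomy X 0 with hlt | h0 | hgt
    · have h1 : K * X ≤ K * (-1) := mul_le_mul_of_nonneg_left (by omega) hK0.le
      linarith
    · exact h0
    · have h1 : K * 1 ≤ K * X := mul_le_mul_of_nonneg_left (by omega) hK0.le
      linarith
  have hY0 : j * ((b 0 : ℕ) : ℤ) + k * ((c 0 : ℕ) : ℤ) = 0 := by
    rw [hX0, mul_zero, zero_add] at hXY; exact hXY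
  have hZ : j * ((b 1 : ℕ) : ℤ) + k * ((c 1 : ℕ) : ℤ) = 0 := by
    have h1 : w 1 * (j * ((b 1 : ℕ) : ℤ) + k * ((c 1 : ℕ) : ℤ)) = 0 := by
      linear_combination hX0 - hX - w 0 * hY0
    exact (mul_eq_zero.mp h1).resolve_left hw1
  -- the `2 × 2` system `Y = Z = 0` has nonzero determinant
  have hdet : ((b 0 : ℕ) : ℤ) * ((c 1 : ℕ) : ℤ) - ((b 1 : ℕ) : ℤ) * ((c 0 : ℕ) : ℤ) ≠ 0 := by
    intro h
    apply hbc
    have h' : ((b 0 * c 1 : ℕ) : ℤ) = ((b 1 * c 0 : ℕ) : ℤ) := by push_cast; linarith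
    exact_mod_cast h'
  have hj0 : j = 0 := by
    have h1 : (((b 0 : ℕ) : ℤ) * ((c 1 : ℕ) : ℤ) - ((b 1 : ℕ) : ℤ) * ((c 0 : ℕ) : ℤ)) * j = 0 := by
      linear_combination ((c 1 : ℕ) : ℤ) * hY0 - ((c 0 : ℕ) : ℤ) * hZ
    exact (mul_eq_zero.mp h1).resolve_left hdet
  have hk0 : k = 0 := by
    have h1 : (((b 0 : ℕ) : ℤ) * ((c 1 : ℕ) : ℤ) - ((b 1 : ℕ) : ℤ) * ((c 0 : ℕ) : ℤ)) * k = 0 := by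
      linear_combination ((b 0 : ℕ) : ℤ) * hZ - ((b 1 : ℕ) : ℤ) * hY0
    exact (mul_eq_zero.mp h1).resolve_left hdet
  have hx0 : ((s 0 : ℕ) : ℤ) = s' 0 := by omega
  have hx1 : ((s 1 : ℕ) : ℤ) = s' 1 := by omega
  ext i
  fin_cases i
  · exact_mod_cast hx0
  · exact_mod_cast hx1

/-- **Core of the net rung (transversal generators).** Let `B`, `C` be nonzero bivariate
polynomials whose support points are pairwise transversal (`b₀ c₁ ≠ b₁ c₀`), let `P` have all
exponents `≤ (N, N)`, and let `D = ∑_{s ∈ supp P} P_s • B ^ s₀ * C ^ s₁`.  Then every strict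
minimiser `e` over `supp D` of a linear form `w₀ x + w₁ y` with `w₁ ≠ 0` (in particular every
south-west vertex of `D`) is `s₀ • b + s₁ • c` for some `s ∈ supp P`, `b ∈ supp B`,
`c ∈ supp C`. [folklore] -/
theorem vertex_eq_of_transversal (B C P D : MvPolynomial (Fin 2) ℂ) (hB : B ≠ 0) (hC : C ≠ 0)
    (htr : ∀ b ∈ B.support, ∀ c ∈ C.support, b 0 * c 1 ≠ b 1 * c 0)
    (N : ℕ) (hN : ∀ s ∈ P.support, s 0 ≤ N ∧ s 1 ≤ N)
    (hD : D = ∑ s ∈ P.support, coeff s P • (B ^ (s 0) * C ^ (s 1)))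
    (w : Fin 2 → ℤ) (hw1 : w 1 ≠ 0) (e : Fin 2 →₀ ℕ) (he : e ∈ D.support)
    (hmin : ∀ e' ∈ D.support, e' ≠ e →
      w 0 * (e 0 : ℤ) + w 1 * (e 1 : ℤ) < w 0 * (e' 0 : ℤ) + w 1 * (e' 1 : ℤ)) :
    ∃ s ∈ P.support, ∃ b ∈ B.support, ∃ c ∈ C.support, s 0 • b + s 1 • c = e := by
  classical
  -- a bound `M` on every `x`-coordinate in `supp D ∪ supp B ∪ supp C`
  obtain ⟨M, hM⟩ : ∃ M : ℕ, ∀ q ∈ D.support ∪ B.support ∪ C.support, q 0 ≤ M :=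
    ⟨(D.support ∪ B.support ∪ C.support).sup (fun q => q 0), fun q hq =>
      Finset.le_sup (f := fun q : Fin 2 →₀ ℕ => q 0) hq⟩
  -- the scale `K`
  obtain ⟨K, hKlt, hKN⟩ : ∃ K : ℤ,
      (∀ q ∈ D.support ∪ B.support ∪ C.support, ((q 0 : ℕ) : ℤ) < K) ∧
      ∀ b ∈ B.support, ∀ c ∈ C.support, (N : ℤ) * (b 0 : ℤ) + (N : ℤ) * (c 0 : ℤ) < K := by
    have hN0 : (0 : ℤ) ≤ N := Nat.cast_nonneg _
    have hM0 : (0 : ℤ) ≤ M := Nat.cast_nonneg _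
    have hNM : (0 : ℤ) ≤ (N : ℤ) * (M : ℤ) := mul_nonneg hN0 hM0
    refine ⟨2 * ((N : ℤ) + 1) * ((M : ℤ) + 1), fun q hq => ?_, fun b hb c hc => ?_⟩
    · have h1 : ((q 0 : ℕ) : ℤ) ≤ M := by exact_mod_cast hM q hq
      linarith
    · have h1 : ((b 0 : ℕ) : ℤ) ≤ M := by
        exact_mod_cast hM b (Finset.mem_union_left _ (Finset.mem_union_right _ hb))
      have h2 : ((c 0 : ℕ) : ℤ) ≤ M := by exact_mod_cast hM c (Finset.mem_union_right _ hc)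
      have h3 := mul_le_mul_of_nonneg_left h1 hN0
      have h4 := mul_le_mul_of_nonneg_left h2 hN0
      linarith
  -- the perturbed weight
  obtain ⟨ω, hω⟩ : ∃ ω : (Fin 2 →₀ ℕ) → ℤ,
      ∀ q, ω q = K * (w 0 * (q 0 : ℤ) + w 1 * (q 1 : ℤ)) + (q 0 : ℤ) := ⟨_, fun q => rfl⟩
  have hadd : ∀ p q, ω (p + q) = ω p + ω q := by
    intro p q
    simp only [hω, Finsupp.coe_add, Pi.add_apply, Nat.cast_add]
    ring
  -- strict `ω`-minimisers `b`, `c` of `supp B`, `supp C`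
  obtain ⟨b, hb, hbmin⟩ := exists_strictMin K w hw1 ω hω B.support (support_nonempty.mpr hB)
    fun q hq => hKlt q (Finset.mem_union_left _ (Finset.mem_union_right _ hq))
  obtain ⟨c, hc, hcmin⟩ := exists_strictMin K w hw1 ω hω C.support (support_nonempty.mpr hC)
    fun q hq => hKlt q (Finset.mem_union_right _ hq)
  -- `s 0 • b + s 1 • c` is the strict `ω`-minimiser of `supp (B ^ s 0 * C ^ s 1)`
  have hT : ∀ s : Fin 2 →₀ ℕ, (s 0 • b + s 1 • c) ∈ (B ^ (s 0) * C ^ (s 1)).support ∧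
      ∀ q ∈ (B ^ (s 0) * C ^ (s 1)).support, q ≠ s 0 • b + s 1 • c →
        ω (s 0 • b + s 1 • c) < ω q := by
    intro s
    obtain ⟨-, hm1, hs1⟩ := strictMin_pow ω hadd B b hb hbmin (s 0)
    obtain ⟨-, hm2, hs2⟩ := strictMin_pow ω hadd C c hc hcmin (s 1)
    obtain ⟨-, hm, hs⟩ := strictMin_mul ω hadd (B ^ (s 0)) (C ^ (s 1)) _ _ hm1 hs1 hm2 hs2
    exact ⟨hm, hs⟩
  have hTle : ∀ (s q : Fin 2 →₀ ℕ), q ∈ (B ^ (s 0) * C ^ (s 1)).support →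
      ω (s 0 • b + s 1 • c) ≤ ω q := fun s q hq =>
    (eq_or_ne q (s 0 • b + s 1 • c)).elim (fun h => h ▸ le_rfl) fun h => ((hT s).2 q hq h).le
  have hωE : ∀ s : Fin 2 →₀ ℕ, ω (s 0 • b + s 1 • c) = (s 0 : ℤ) * ω b + (s 1 : ℤ) * ω c := by
    intro s
    rw [hadd, wt_nsmul ω hadd, wt_nsmul ω hadd]
  -- `supp P` is nonempty, as `D ≠ 0`
  have hPne : P.support.Nonempty := by
    rw [Finset.nonempty_iff_ne_empty]
    intro h
    rw [hD, h, Finset.sum_empty] at he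
    simp at he
  -- the unique `F`-minimiser `t` of `supp P`
  obtain ⟨t, ht, htle⟩ : ∃ t ∈ P.support, ∀ s ∈ P.support,
      ω (t 0 • b + t 1 • c) ≤ ω (s 0 • b + s 1 • c) :=
    Finset.exists_min_image P.support (fun s => ω (s 0 • b + s 1 • c)) hPne
  have htmin : ∀ s ∈ P.support, s ≠ t → ω (t 0 • b + t 1 • c) < ω (s 0 • b + s 1 • c) := by
    intro s hs hst
    refine lt_of_le_of_ne (htle s hs) fun heq => hst ?_
    rw [hωE, hωE] at heq
    exact (nsmul_wt_injective K w hw1 ω hω b c (htr b hb c hc) N (hKN b hb c hc) t s (hN t ht)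
      (hN s hs) heq).symm
  -- the coefficient of `D` at `t 0 • b + t 1 • c`
  have hcoeff : coeff (t 0 • b + t 1 • c) D =
      coeff t P * coeff (t 0 • b + t 1 • c) (B ^ (t 0) * C ^ (t 1)) := by
    rw [hD, coeff_sum, Finset.sum_eq_single_of_mem t ht]
    · rw [coeff_smul, smul_eq_mul]
    · intro s hs hst
      rw [coeff_smul]
      have h0 : coeff (t 0 • b + t 1 • c) (B ^ (s 0) * C ^ (s 1)) = 0 := by
        by_contra hne
        exact absurd (hTle s _ (mem_support_iff.mpr hne)) (not_le.mpr (htmin s hs hst))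
      rw [h0, smul_zero]
  have hmem : (t 0 • b + t 1 • c) ∈ D.support := by
    rw [mem_support_iff, hcoeff]
    exact mul_ne_zero (mem_support_iff.mp ht) (mem_support_iff.mp (hT t).1)
  have hstrict : ∀ q ∈ D.support, q ≠ t 0 • b + t 1 • c → ω (t 0 • b + t 1 • c) < ω q := by
    intro q hq hne
    rw [hD] at hq
    obtain ⟨s, hs, hqs⟩ := Finset.mem_biUnion.mp (support_sum hq)
    have hqs' : q ∈ (B ^ (s 0) * C ^ (s 1)).support := support_smul hqs
    rcases eq_or_ne s t with rfl | hst
    · exact (hT s).2 q hqs' hne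
    · exact (htmin s hs hst).trans_le (hTle s q hqs')
  -- `ω` refines `wt_w` strictly on `supp D`, so `e` is the `ω`-minimiser
  refine ⟨t, ht, b, hb, c, hc, ?_⟩
  by_contra hne
  have h1 := hmin _ hmem hne
  have h2 := hstrict e he (Ne.symm hne)
  have heK : ((e 0 : ℕ) : ℤ) < K := hKlt e (Finset.mem_union_left _ (Finset.mem_union_left _ he))
  have h3 := K_separates (K := K) (Nat.cast_nonneg _) heK (Nat.cast_nonneg ((t 0 • b + t 1 • c) 0)) h1
  rw [hω, hω] at h2
  exact lt_asymm h3 h2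

/-- Exponents of the net polynomial `P = ∏ (1 + α_i X + α'_i Y) - ∏ (1 + β_i X + β'_i Y)` are at
most `n` in each coordinate (its total degree is at most `n`). [folklore] -/
theorem support_le_of_net (n : ℕ) (α α' β β' : Fin n → ℂ) (P : MvPolynomial (Fin 2) ℂ)
    (hP : P = (∏ i, (1 + C (α i) * X 0 + C (α' i) * X 1)) -
      ∏ i, (1 + C (β i) * X 0 + C (β' i) * X 1))
    (s : Fin 2 →₀ ℕ) (hs : s ∈ P.support) : s 0 ≤ n ∧ s 1 ≤ n := by
  have hfac : ∀ a a' : ℂ,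
      (1 + C a * X 0 + C a' * X 1 : MvPolynomial (Fin 2) ℂ).totalDegree ≤ 1 := by
    intro a a'
    refine (totalDegree_add _ _).trans (max_le ((totalDegree_add _ _).trans (max_le ?_ ?_)) ?_)
    · simp [totalDegree_one]
    · exact (totalDegree_mul _ _).trans (by simp [totalDegree_C, totalDegree_X])
    · exact (totalDegree_mul _ _).trans (by simp [totalDegree_C, totalDegree_X])
  have hprod : ∀ a a' : Fin n → ℂ,
      (∏ i, (1 + C (a i) * X 0 + C (a' i) * X 1) : MvPolynomial (Fin 2) ℂ).totalDegree ≤ n := by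
    intro a a'
    refine (totalDegree_finsetProd _ _).trans ?_
    calc ∑ i, (1 + C (a i) * X 0 + C (a' i) * X 1 : MvPolynomial (Fin 2) ℂ).totalDegree
        ≤ ∑ _i : Fin n, 1 := Finset.sum_le_sum fun i _ => hfac (a i) (a' i)
      _ = n := by simp
  have hdeg : P.totalDegree ≤ n := by
    rw [hP]
    exact (totalDegree_sub _ _).trans (max_le (hprod α α') (hprod β β'))
  exact ⟨(monomial_le_degreeOf 0 hs).trans ((degreeOf_le_totalDegree P 0).trans hdeg),
    (monomial_le_degreeOf 1 hs).trans ((degreeOf_le_totalDegree P 1).trans hdeg)⟩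

/-- **Net rung, transversal generators** (rung `stub_engineNetTransversal`, registered signature):
if all tails lie in the net `ℂ B + ℂ C` of two nonzero constant-free polynomials with pairwise
transversal supports, then `∏ (1 + α_i B + α'_i C) - ∏ (1 + β_i B + β'_i C)` has at most
`(n + 1)² |supp B| |supp C|` south-west vertices. [folklore] -/
theorem stub_engineNetTransversal : ∀ (n : ℕ) (B C : MvPolynomial (Fin 2) ℂ) (α α' β β' : Fin n → ℂ),
    MvPolynomial.coeff 0 B = 0 → MvPolynomial.coeff 0 C = 0 → B ≠ 0 → C ≠ 0 →
    (∀ b ∈ B.support, ∀ c ∈ C.support, b 0 * c 1 ≠ b 1 * c 0) →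
    {e : Fin 2 →₀ ℕ | ∃ w : Fin 2 → ℤ, 0 < w 0 ∧ 0 < w 1 ∧
        e ∈ ((∏ i, (1 + MvPolynomial.C (α i) * B + MvPolynomial.C (α' i) * C)) -
              ∏ i, (1 + MvPolynomial.C (β i) * B + MvPolynomial.C (β' i) * C)).support ∧
        ∀ e' ∈ ((∏ i, (1 + MvPolynomial.C (α i) * B + MvPolynomial.C (α' i) * C)) -
              ∏ i, (1 + MvPolynomial.C (β i) * B + MvPolynomial.C (β' i) * C)).support, e' ≠ e →
          w 0 * (e 0 : ℤ) + w 1 * (e 1 : ℤ) < w 0 * (e' 0 : ℤ) + w 1 * (e' 1 : ℤ)}.ncard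
      ≤ (n + 1) ^ 2 * B.support.card * C.support.card := by
  intro n B G α α' β β' _ _ hB hG htr
  classical
  -- the net polynomial `P`, with `D = P(B, G) = ∑_s P_s • B ^ s 0 * G ^ s 1`
  obtain ⟨P, hP⟩ : ∃ P : MvPolynomial (Fin 2) ℂ, P = (∏ i, (1 + C (α i) * X 0 + C (α' i) * X 1)) -
      ∏ i, (1 + C (β i) * X 0 + C (β' i) * X 1) := ⟨_, rfl⟩
  have hN : ∀ s ∈ P.support, s 0 ≤ n ∧ s 1 ≤ n := fun s hs =>
    support_le_of_net n α α' β β' P hP s hs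
  have h1 : aeval ![B, G] P =
      (∏ i, (1 + C (α i) * B + C (α' i) * G)) - ∏ i, (1 + C (β i) * B + C (β' i) * G) := by
    rw [hP]
    simp only [map_sub, map_prod, map_add, map_one, map_mul, aeval_C, aeval_X, algebraMap_eq,
      Matrix.cons_val_zero, Matrix.cons_val_one]
  have hD : (∏ i, (1 + C (α i) * B + C (α' i) * G)) - ∏ i, (1 + C (β i) * B + C (β' i) * G) =
      ∑ s ∈ P.support, coeff s P • (B ^ (s 0) * G ^ (s 1)) := by
    rw [← h1, aeval_def, eval₂_eq']
    refine Finset.sum_congr rfl fun s _ => ?_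
    rw [Fin.prod_univ_two, algebraMap_eq, C_mul']
    simp
  refine (Set.ncard_le_ncard (t := (fun x : (ℕ × ℕ) × ((Fin 2 →₀ ℕ) × (Fin 2 →₀ ℕ)) =>
      x.1.1 • x.2.1 + x.1.2 • x.2.2) '' ↑((Finset.range (n + 1) ×ˢ Finset.range (n + 1)) ×ˢ
        (B.support ×ˢ G.support))) ?_ ((Finset.finite_toSet _).image _)).trans ?_
  · rintro e ⟨w, -, hw1, he, hmin⟩
    obtain ⟨s, hs, b, hb, c, hc, hsum⟩ :=
      vertex_eq_of_transversal B G P _ hB hG htr n hN hD w hw1.ne' e he hmin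
    refine ⟨((s 0, s 1), (b, c)), ?_, hsum⟩
    obtain ⟨hs0, hs1⟩ := hN s hs
    simp only [Finset.coe_product, Set.mem_prod, Finset.mem_coe, Finset.mem_range]
    exact ⟨⟨by omega, by omega⟩, hb, hc⟩
  · refine (Set.ncard_image_le (Finset.finite_toSet _)).trans ?_
    rw [Set.ncard_coe_finset, Finset.card_product, Finset.card_product, Finset.card_product,
      Finset.card_range]
    exact le_of_eq (by ring)

end Summit.ValiantsHypothesis.ValiantsHypothesis.Theorems.TwoProducts.NetTransversal
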